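/-
VALUE = DECIDABLE VERDICT at p = 7 (one compiled evaluation of the certificate of
`ReflectionClassCertificateBFS`), NOT summit progress (cell b2b-lgcu-borel, gen 23); the crux item
stmt-MatrixMultiplication-14079 is untouched.
-/
import Mathlib
import Summits.MatrixMultiplication.MatrixMultiplication.Theorems.SubgroupIdentityDesigns.Negative.ReflectionClassCertificateBFS

/-!
# No member contains the square reflections of `𝔽₇^m`: the class `Ω₃(𝔽₇) × ⟨−1⟩`

VALUE = DECIDABLE VERDICT (`p = 7`, every `ε`, every `m ≥ 3`, no TPP, no budget), NOT summit
progress; the crux item stmt-MatrixMultiplication-14079 is untouched and remains open.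

THE CLASS.  `K = ⟨R_b : b·b ∈ {1, 2, 4}⟩ = Ω₃(𝔽₇) × ⟨−1⟩ ≅ PSL₂(𝔽₇) × C₂`, order `336`, generated
by the `21` square reflections of `(𝔽₇³, x² + y² + z²)`: the `p = 7` instance of the one `m = 3`
reflection class (sign `−χ(−1)`, here the square class since `7 ≡ 3 (mod 4)`) that no structural
criterion of this folder reaches (`SquareReflections` needs `p ≡ 1 (mod 4)` or `m ≥ 4`).

THE VERDICT.  `cert_seven : certG (KSG (gens ws) 14) (gens ws) true ws 1 X₀ = true`
(`native_decide`; `X₀ = (0, 0, 1)` on the sphere `Q = 1`; `ws` = the three generator words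
`r_a r_b`, `r_b r_a`, `r_c` below, breadth-first depth `14`): the closure has the `336` elements of
`K`, is closed, orthogonal with `det = ±1`, and every twisted-stabiliser orbit sum of the weight
`w(v) = χ(Q(v − X₀)) − χ(Q(v + X₀)) + 2χ(2v·X₀) + 7([v = X₀] − [v = −X₀])`
on the sphere vanishes while `w(X₀) = 8`.  By `ReflectionClassCertificateBFS.no_design_sq_memᵢ_of_certG`:

THEOREMS `no_design_sq_mem₁/₂/₃_seven`: NO MEMBER OF A TRIPLE IN `GL_m(𝔽₇)`, `m ≥ 3`, CARRYING
A LEVEL-ONE IDENTITY DESIGN CONTAINS ALL SQUARE REFLECTIONS OF `𝔽₇^m`.  Together with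
`SquareReflections` (`p ≡ 1 (mod 4)`, and every odd `p` for `m ≥ 4`), `NonsquareReflections`
(`p ≡ 3 (mod 4)`), `NonsquareReflectionsFour` and `NonsquareReflectionsFive`: for `p ∈ {3, 5, 7}`
no member contains all reflections of either square class of `𝔽_p^m`, `m ≥ 3`.

HONEST SCOPE.  Configuration exclusion at `p = 7`; no `(p,m,ε)` cell is emptied.
-/

set_option linter.dupNamespace false

open scoped BigOperators Matrix

namespace Summit.MatrixMultiplication.MatrixMultiplication.Theorems.SubgroupIdentityDesigns.Negative
namespace SquareReflectionsSeven

open Summit.MatrixMultiplication.MatrixMultiplication.Theorems.LieRankDesigns.Negative (GLm Mat)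
open NonsquareReflections (refl)
open ReflectionClassCertificate (V)
open ReflectionClassCertificateBFS (gens KSG certG no_design_sq_mem₁_of_certG
  no_design_sq_mem₂_of_certG no_design_sq_mem₃_of_certG)

/-- `7` is prime (instance for the level vocabulary at `p = 7`). -/
instance fact_prime_seven : Fact (Nat.Prime 7) := ⟨by norm_num⟩

/-- The base point `X₀ = (0, 0, 1)` of the sphere `Q = 1` in `𝔽₇³`. -/
def X₀ : V 7 := ![0, 0, 1]

/-- The generator words: `r_a r_b`, its inverse `r_b r_a`, and one reflection `r_c` (all three
vectors have `b·b` a non-zero square mod `7`). -/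
def ws : List (List (V 7)) :=
  [[![0, 0, 1], ![1, 6, 4]], [![1, 6, 4], ![0, 0, 1]], [![1, 5, 5]]]

/-- **THE CERTIFICATE OF THE SQUARE CLASS AT `p = 7`, EVALUATED.** -/
theorem cert_seven : certG (KSG (gens ws) 14) (gens ws) true ws 1 X₀ = true := by
  native_decide

variable {m : ℕ} {H₁ H₂ H₃ : Subgroup (GLm 7 m)}

/-- **NO MEMBER OF A TRIPLE IN `GL_m(𝔽₇)`, `m ≥ 3`, WITH A LEVEL-ONE IDENTITY DESIGN CONTAINS ALL
SQUARE REFLECTIONS OF `𝔽₇^m`**: member `1`. -/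
theorem no_design_sq_mem₁_seven (hm : 3 ≤ m)
    (h₁ : ∀ b : Fin m → ZMod 7, b ⬝ᵥ b ≠ 0 → IsSquare (b ⬝ᵥ b) → refl b ∈ H₁) :
    ¬ ∃ c : Mat 7 m → ℂ, (∀ M, 1 < M.rank → c M = 0) ∧
      (∑ M, c M * ZMod.stdAddChar (Matrix.trace (M * ((1 : GLm 7 m) : Mat 7 m)))) = 1 ∧
      ∀ a ∈ H₁, ∀ b ∈ H₂, ∀ g ∈ H₃, a * b * g ≠ 1 →
        (∑ M, c M * ZMod.stdAddChar (Matrix.trace (M * ((a * b * g : GLm 7 m) : Mat 7 m)))) = 0 :=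
  no_design_sq_mem₁_of_certG cert_seven hm h₁

/-- Member `2`. -/
theorem no_design_sq_mem₂_seven (hm : 3 ≤ m)
    (h₂ : ∀ b : Fin m → ZMod 7, b ⬝ᵥ b ≠ 0 → IsSquare (b ⬝ᵥ b) → refl b ∈ H₂) :
    ¬ ∃ c : Mat 7 m → ℂ, (∀ M, 1 < M.rank → c M = 0) ∧
      (∑ M, c M * ZMod.stdAddChar (Matrix.trace (M * ((1 : GLm 7 m) : Mat 7 m)))) = 1 ∧
      ∀ a ∈ H₁, ∀ b ∈ H₂, ∀ g ∈ H₃, a * b * g ≠ 1 →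
        (∑ M, c M * ZMod.stdAddChar (Matrix.trace (M * ((a * b * g : GLm 7 m) : Mat 7 m)))) = 0 :=
  no_design_sq_mem₂_of_certG cert_seven hm h₂

/-- Member `3`. -/
theorem no_design_sq_mem₃_seven (hm : 3 ≤ m)
    (h₃ : ∀ b : Fin m → ZMod 7, b ⬝ᵥ b ≠ 0 → IsSquare (b ⬝ᵥ b) → refl b ∈ H₃) :
    ¬ ∃ c : Mat 7 m → ℂ, (∀ M, 1 < M.rank → c M = 0) ∧
      (∑ M, c M * ZMod.stdAddChar (Matrix.trace (M * ((1 : GLm 7 m) : Mat 7 m)))) = 1 ∧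
      ∀ a ∈ H₁, ∀ b ∈ H₂, ∀ g ∈ H₃, a * b * g ≠ 1 →
        (∑ M, c M * ZMod.stdAddChar (Matrix.trace (M * ((a * b * g : GLm 7 m) : Mat 7 m)))) = 0 :=
  no_design_sq_mem₃_of_certG cert_seven hm h₃

end SquareReflectionsSeven
end Summit.MatrixMultiplication.MatrixMultiplication.Theorems.SubgroupIdentityDesigns.Negative
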